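import Summits.Ventures.HodgeRepro2.T5SmoothVectorsDense
import Summits.Ventures.HodgeRepro2.T5IsotypicHilbertSum
import Summits.Ventures.HodgeRepro2.T5AdmissibilityHilbert

/-!
# T5IsotypicPartsDense — STEP 3 (γ) derived: «L = ⊕̂_π L_π» from STEP 2 and the density of the
smooth vectors

Cell pub-hodge-repro2, seat p5, Tier 5 (route/T5-N4-p5.md, N4.3 v13 (A3) STEP 3 (γ), l. 147: «L =
⊕̂_π L_π: by STEP 2 each L^{K_f} ⊂ ⊕̂_π L_π, and ∪_{K_f} L^{K_f} is dense in L»).  Rows 79 / 85–87 take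
the density of the canonical isotypic parts (`hdense`) as a hypothesis; this file DERIVES it, on the
Hilbert model of row 87, from

* the decomposition of every `L^{K'}` («STEP 2», rows 53 / 65 / 72 / 75: irreducible closed
  `A`-stable members with dense sum),
* the completeness of the family `σ π` (`hrep`: every irreducible closed `A`-stable subspace of `E`
  is a copy of some `σ π` — `P` is a set of representatives of the irreducible unitary
  representations of `A` occurring in `E`), and
* the density of `⋃_{K'} L^{K'}` (row 15, `T5SmoothVectorsDense.dense_setOf_exists_openSubgroup_fixed`,
  for the compact totally disconnected `K₂` acting strongly continuously through `κ₂`).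

* `le_isotypicPart_of_irreducibleOn`: a `ρ ∘ inl`-irreducible member is a copy of some `σ π`, hence
  lies in the canonical isotypic part `isotypicPart (ρ.comp inl) (σ π)`;
* `invariants_le_closure_iSup_isotypicPart`: hence `L^{K'} ≤ closure (⨆ π, L_π)`;
* `dense_iUnion_invariants`: `⋃_{K'} L^{K'}` is dense (row 15);
* **`closure_iSup_isotypicPart_eq_top`**: `closure (⨆ π, L_π) = ⊤` — row 87's `hdense`;
* **`finite_isotypicComponent_restrictProd_of_decompositions`**: row 87's conclusion (the
  `ρτ`-isotypic part of the irreducible `π₀` is finite-dimensional) with `hdense` replaced by its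
  sources `hrep` / `hcont` / `hdec`.

Imports rows 15 / 16 / 87.  Axioms: propext, Classical.choice, Quot.sound.
README §8(d): uses an L-value-free non-vanishing device: NO.
-/

namespace Summit.Ventures.HodgeRepro2.T5IsotypicPartsDense

open scoped InnerProductSpace
open Summit.Ventures.HodgeRepro2.T5CompactDiscreteDecomposition (IrreducibleOn)
open Summit.Ventures.HodgeRepro2.T5IsotypicStep4Adelic (copies isotypicPart)
open Summit.Ventures.HodgeRepro2.T5AdmissibilityHilbert (invariants mem_invariants isClosed_invariants)

variable {E : Type*} [NormedAddCommGroup E] [InnerProductSpace ℂ E] [CompleteSpace E]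
variable {A B : Type*} [Group A] [Group B]
variable {P : Type*} {F : P → Type*} [∀ π, NormedAddCommGroup (F π)]
  [∀ π, InnerProductSpace ℂ (F π)]

omit [CompleteSpace E] in
/-- An irreducible closed `A`-stable subspace that is a copy of `σ π` lies in the canonical
`σ π`-isotypic part. -/
theorem le_isotypicPart_of_irreducibleOn (ρA : A →* (E →L[ℂ] E)) (σ : ∀ π, A →* (F π →L[ℂ] F π))
    {W : Submodule ℂ E} (hW : IrreducibleOn ρA W) {π : P} (V : F π ≃ₗᵢ[ℂ] W)
    (hV : ∀ a x, (V (σ π a x) : E) = ρA a (V x)) : W ≤ isotypicPart ρA (σ π) := by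
  have hmem : W ∈ copies ρA (σ π) := ⟨hW.1, hW.2.1, V, hV⟩
  exact le_trans (le_sSup hmem) (Submodule.le_topologicalClosure _)

omit [CompleteSpace E] in
/-- **«each L^{K_f} ⊂ ⊕̂_π L_π»**: if `L^{K'}` is the closure of the sum of a family of irreducible
closed `A`-stable subspaces (STEP 2) each of which is a copy of some `σ π` (`hrep`), then
`L^{K'} ≤ closure (⨆ π, L_π)`. -/
theorem invariants_le_closure_iSup_isotypicPart (ρA : A →* (E →L[ℂ] E))
    (σ : ∀ π, A →* (F π →L[ℂ] F π))
    (hrep : ∀ W : Submodule ℂ E, IrreducibleOn ρA W →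
      ∃ (π : P) (V : F π ≃ₗᵢ[ℂ] W), ∀ a x, (V (σ π a x) : E) = ρA a (V x))
    {L : Submodule ℂ E} {S : Set (Submodule ℂ E)} (hS : ∀ W ∈ S, IrreducibleOn ρA W)
    (hSd : (sSup S).topologicalClosure = L) :
    L ≤ (⨆ π, isotypicPart ρA (σ π)).topologicalClosure := by
  rw [← hSd]
  apply Submodule.topologicalClosure_mono
  refine sSup_le fun W hW => ?_
  obtain ⟨π, V, hV⟩ := hrep W (hS W hW)
  exact le_trans (le_isotypicPart_of_irreducibleOn ρA σ (hS W hW) V hV)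
    (le_iSup (fun π => isotypicPart ρA (σ π)) π)

section Dense

variable {K₂ : Type*} [Group K₂] [TopologicalSpace K₂] [IsTopologicalGroup K₂] [CompactSpace K₂]
  [TotallyDisconnectedSpace K₂] [T2Space K₂]

/-- The `K₂`-part `k ↦ ρ (1, κ₂ k)` of `ρ`. -/
def inrPart (ρ : A × B →* (E →L[ℂ] E)) (κ₂ : K₂ →* B) : K₂ →* (E →L[ℂ] E) :=
  ρ.comp ((MonoidHom.inr A B).comp κ₂)

omit [CompleteSpace E] [TopologicalSpace K₂] in
/-- `inrPart ρ κ₂ k = ρ (1, κ₂ k)`. -/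
@[simp] theorem inrPart_apply (ρ : A × B →* (E →L[ℂ] E)) (κ₂ : K₂ →* B) (k : K₂) :
    inrPart ρ κ₂ k = ρ (1, κ₂ k) := rfl

/-- **«∪_{K_f} L^{K_f} is dense in L»** (row 15): for the compact totally disconnected `K₂` acting
strongly continuously, the union of the invariants of the open subgroups is dense. -/
theorem dense_iUnion_invariants (ρ : A × B →* (E →L[ℂ] E)) (κ₂ : K₂ →* B)
    (hcont : ∀ v : E, Continuous fun k : K₂ => ρ (1, κ₂ k) v) :
    Dense (⋃ K' : OpenSubgroup K₂, ((invariants ρ κ₂ (K' : Set K₂) : Submodule ℂ E) : Set E)) := by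
  have h := T5SmoothVectorsDense.dense_setOf_exists_openSubgroup_fixed (inrPart ρ κ₂)
    (fun v => by simpa only [inrPart_apply] using hcont v)
  refine h.mono ?_
  intro f hf
  obtain ⟨H, hH⟩ := hf
  refine Set.mem_iUnion.mpr ⟨H, ?_⟩
  rw [SetLike.mem_coe, mem_invariants]
  intro k hk
  simpa only [inrPart_apply] using hH k hk

/-- **STEP 3 (γ) derived: `closure (⨆ π, L_π) = ⊤`** — the `hdense` hypothesis of rows 79 / 85–87 —
from a decomposition of every `L^{K'}` (STEP 2), the completeness of the family `σ π` (`hrep`) and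
the density of the smooth vectors (row 15). -/
theorem closure_iSup_isotypicPart_eq_top (ρ : A × B →* (E →L[ℂ] E))
    (σ : ∀ π, A →* (F π →L[ℂ] F π)) (κ₂ : K₂ →* B)
    (hcont : ∀ v : E, Continuous fun k : K₂ => ρ (1, κ₂ k) v)
    (hrep : ∀ W : Submodule ℂ E, IrreducibleOn (ρ.comp (MonoidHom.inl A B)) W →
      ∃ (π : P) (V : F π ≃ₗᵢ[ℂ] W), ∀ a x, (V (σ π a x) : E) = (ρ.comp (MonoidHom.inl A B)) a (V x))
    (hdec : ∀ K' : OpenSubgroup K₂, ∃ S : Set (Submodule ℂ E),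
      (∀ W ∈ S, IrreducibleOn (ρ.comp (MonoidHom.inl A B)) W) ∧
      (sSup S).topologicalClosure = invariants ρ κ₂ (K' : Set K₂)) :
    (⨆ π, isotypicPart (ρ.comp (MonoidHom.inl A B)) (σ π)).topologicalClosure = ⊤ := by
  set C := (⨆ π, isotypicPart (ρ.comp (MonoidHom.inl A B)) (σ π)).topologicalClosure with hC
  have hCc : IsClosed (C : Set E) := Submodule.isClosed_topologicalClosure _
  have hle : ∀ K' : OpenSubgroup K₂, invariants ρ κ₂ (K' : Set K₂) ≤ C := by
    intro K'
    obtain ⟨S, hS, hSd⟩ := hdec K'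
    exact invariants_le_closure_iSup_isotypicPart (ρ.comp (MonoidHom.inl A B)) σ hrep hS hSd
  have hdense := dense_iUnion_invariants ρ κ₂ hcont
  have hsub : (⋃ K' : OpenSubgroup K₂, ((invariants ρ κ₂ (K' : Set K₂) : Submodule ℂ E) : Set E)) ⊆
      (C : Set E) := by
    intro x hx
    obtain ⟨K', hK'⟩ := Set.mem_iUnion.mp hx
    exact hle K' hK'
  have hCdense : Dense (C : Set E) := hdense.mono hsub
  have huniv : (C : Set E) = Set.univ := by
    rw [← hCc.closure_eq]
    exact hCdense.closure_eq
  exact Submodule.eq_top_iff'.mpr fun x => by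
    have : x ∈ (C : Set E) := by rw [huniv]; trivial
    exact this

end Dense

section Assembled

variable {K₁ K₂ : Type*} [Group K₁] [Group K₂] [TopologicalSpace K₂] [IsTopologicalGroup K₂]
  [CompactSpace K₂] [TotallyDisconnectedSpace K₂] [T2Space K₂]

open Summit.Ventures.HodgeRepro2.T5FiniteMultiplicity (IsUnitaryEquiv)
open Summit.Ventures.HodgeRepro2.T5FiniteCopiesModule (toRep)
open Summit.Ventures.HodgeRepro2.T5IsotypicRestrict (compRep)
open Summit.Ventures.HodgeRepro2.T5AdmissibilityHilbert (restrictProd)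

variable [∀ π, CompleteSpace (F π)]

/-- **(A3) item (a) on the Hilbert model with STEP 3 (γ) derived**: row 87's
`exists_openSubgroup_finite_isotypicComponent_restrictProd` with the density hypothesis replaced by its
sources — the completeness of the family `σ π` (`hrep`), the strong continuity of the `K₂`-action
(`hcont`) and a decomposition of `L^{K'}` for every open `K'` (`hdec`, STEP 2).  For a closed
`ρ`-irreducible `W₀` lying in `L_π` and a `K`-type `ρτ` with a simple `S₁ ≤ ρτ|_{K₁}` and `H_π[S₁]`
finite-dimensional, the `ρτ`-isotypic part of `W₀` is finite-dimensional. -/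
theorem finite_isotypicComponent_restrictProd_of_decompositions {ρ : A × B →* (E →L[ℂ] E)}
    (hρ : ∀ g, star (ρ g) = ρ g⁻¹)
    (σ : ∀ π, A →* (F π →L[ℂ] F π)) (hσ : ∀ π a, star (σ π a) = σ π a⁻¹)
    (hσirr : ∀ π, ∀ V : Submodule ℂ (F π), IsClosed (V : Set (F π)) →
      (∀ a, ∀ v ∈ V, σ π a v ∈ V) → V = ⊥ ∨ V = ⊤)
    (hne : ∀ π π', π ≠ π' → ∀ V : F π ≃ₗᵢ[ℂ] F π', ¬ ∀ a x, V (σ π a x) = σ π' a (V x))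
    (hrep : ∀ W : Submodule ℂ E, IrreducibleOn (ρ.comp (MonoidHom.inl A B)) W →
      ∃ (π : P) (V : F π ≃ₗᵢ[ℂ] W), ∀ a x, (V (σ π a x) : E) = (ρ.comp (MonoidHom.inl A B)) a (V x))
    (κ₁ : K₁ →* A) (κ₂ : K₂ →* B)
    (hcont : ∀ v : E, Continuous fun k : K₂ => ρ (1, κ₂ k) v)
    (hdec : ∀ K' : OpenSubgroup K₂, ∃ S : Set (Submodule ℂ E),
      (∀ W ∈ S, IrreducibleOn (ρ.comp (MonoidHom.inl A B)) W) ∧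
      S.Pairwise (fun W W' => W ⟂ W') ∧
      (sSup S).topologicalClosure = invariants ρ κ₂ (K' : Set K₂) ∧
      ∀ W₀ ∈ S, {W ∈ S | IsUnitaryEquiv (ρ.comp (MonoidHom.inl A B)) W₀ W}.Finite)
    (π : P) [Nontrivial (F π)] {W₀ : Submodule ℂ E}
    (ρW₀ : A × B →* (W₀ →L[ℂ] W₀)) (hρW₀ : ∀ g (w : W₀), (ρW₀ g w : E) = ρ g w)
    (hπ : W₀ ≤ isotypicPart (ρ.comp (MonoidHom.inl A B)) (σ π))
    {V : Type*} [NormedAddCommGroup V] [InnerProductSpace ℂ V] [FiniteDimensional ℂ V]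
    (ρτ : Representation ℂ (K₁ × K₂) V) [ρτ.IsIrreducible]
    (S₁ : Submodule (MonoidAlgebra ℂ K₁) (compRep (MonoidHom.inl K₁ K₂) ρτ).asModule)
    [IsSimpleModule (MonoidAlgebra ℂ K₁) S₁]
    (hnorm : ∀ (k : K₂) (v : V), ‖ρτ (1, k) v‖ = ‖v‖)
    (hcontτ : ∀ v : V, Continuous fun k : K₂ => ρτ (1, k) v)
    [Module.Finite ℂ (isotypicComponent (MonoidAlgebra ℂ K₁) (toRep ((σ π).comp κ₁)).asModule S₁)] :
    Module.Finite ℂ (isotypicComponent (MonoidAlgebra ℂ (K₁ × K₂))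
      (restrictProd ρW₀ κ₁ κ₂).asModule ρτ.asModule) := by
  have hdense : (⨆ π, isotypicPart (ρ.comp (MonoidHom.inl A B)) (σ π)).topologicalClosure = ⊤ :=
    closure_iSup_isotypicPart_eq_top ρ σ κ₂ hcont hrep fun K' => by
      obtain ⟨S, hS, -, hSd, -⟩ := hdec K'
      exact ⟨S, hS, hSd⟩
  exact T5AdmissibilityHilbert.exists_openSubgroup_finite_isotypicComponent_restrictProd hρ σ hσ
    hσirr hne hdense κ₁ κ₂ hdec π ρW₀ hρW₀ hπ ρτ S₁ hnorm hcontτ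

end Assembled

end Summit.Ventures.HodgeRepro2.T5IsotypicPartsDense
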